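import Mathlib.Algebra.Group.Subgroup.Lattice
import Mathlib.Data.Finset.Card
import Mathlib.Data.Fintype.Basic
import Mathlib.Tactic
import Literature.Combinatorics.Additive.TripleProductProperty
import Literature.Computability.AlgebraicComplexity.CohnUmansTPP
import HarnessLib

/-!
# The two-subgroup construction of TPP triples

ω-census contribution from the speedrun lane `tpp` (seat sr-tpp-search-g10, 2026-08-20); source
`run/shared/lean/speedrun/tpp/sr-tpp-search-g10/conj/SubgroupPairTPP.lean`. Framing: lottery ticket; floor = certified bounds/negative ranges.

A SUFFICIENT condition for the triple product property, valid in every group `G`: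
let `A, C ⊆ G` be closed under `x y⁻¹` (e.g. two finite subgroups) with `A ∩ C ⊆ {1}`, and let `T ⊆ G` be a set such that
`a (t t'⁻¹) c ≠ 1` for all `t ≠ t'` in `T`, `a ∈ A`, `c ∈ C` — i.e. `t t'⁻¹ ∉ A⁻¹ C⁻¹ = A C` for `t ≠ t'`, equivalently `T` is an
independent set of the Cayley graph `Cay(G, (A C ∪ C A) \ {1})`.  Then `(A, T, C)` has the TPP (Cohn–Umans right-quotient form), so
`G` realizes `⟨|A|, |T|, |C|⟩`.  With `C = {1, σ}` for an involution `σ ∉ A` this is the "subgroup + involution" ansatz.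

This is the certificate format behind the speedrun-tpp lane's structured lower bounds (seat sr-tpp-search-g10, 2026-08-20, tools
`py/subgrp10.py`, `py/subgrp10b.py`): e.g. the diagonal family `C_K × D_{2M} ⊇ (graph subgroup of order K, T, {1, (0, sr 0)})`
(`CyclicDihedralIndexTwoFamilyDiagK.lean`) and the census lower bounds `β(AG-232-13) ≥ 352 = 4·44·2`, `β(AG-234-15) ≥ 360 = 18·10·2`.
To certify such a witness one checks `|A|² + |C|²` closure products, the disjointness, and `|T|²|A||C|` products — instead of the
`(|A||T||C|)²` sextuples of the raw definition.
-/

namespace Summit.MatrixMultiplication.OmegaCensus.SubgroupPairTPP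

open Literature.Computability.AlgebraicComplexity Literature.Combinatorics.Additive

variable {G : Type*} [Group G]

/-- **Two-subgroup construction.** `A`, `C` closed under `x y⁻¹`, meeting only in `1`, and `T` with `a (t t'⁻¹) c ≠ 1` for `t ≠ t'`:
then `(A, T, C)` satisfies the TPP clause of `RealizesTPP` / `TripleProductProperty`. -/
theorem tpp_of_closed_pair {A T C : Finset G}
    (hA : ∀ a ∈ A, ∀ a' ∈ A, a * a'⁻¹ ∈ A) (hC : ∀ c ∈ C, ∀ c' ∈ C, c * c'⁻¹ ∈ C)
    (hAC : ∀ x ∈ A, x ∈ C → x = 1)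
    (hT : ∀ t ∈ T, ∀ t' ∈ T, t ≠ t' → ∀ a ∈ A, ∀ c ∈ C, a * (t * t'⁻¹) * c ≠ 1) :
    ∀ s ∈ A, ∀ s' ∈ A, ∀ t ∈ T, ∀ t' ∈ T, ∀ u ∈ C, ∀ u' ∈ C,
      s * s'⁻¹ * (t * t'⁻¹) * (u * u'⁻¹) = 1 → s = s' ∧ t = t' ∧ u = u' := by
  intro s hs s' hs' t ht t' ht' u hu u' hu' h
  by_cases htt : t = t'
  · subst htt
    rw [mul_inv_cancel, mul_one] at h
    have ha : s * s'⁻¹ ∈ A := hA s hs s' hs'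
    have hc : u * u'⁻¹ ∈ C := hC u hu u' hu'
    have h1C : (1 : G) ∈ C := by simpa using hC u hu u hu
    have hinvC : (u * u'⁻¹)⁻¹ ∈ C := by simpa using hC 1 h1C (u * u'⁻¹) hc
    have heq : s * s'⁻¹ = (u * u'⁻¹)⁻¹ := eq_inv_of_mul_eq_one_left h
    have hs1 : s * s'⁻¹ = 1 := hAC _ ha (heq ▸ hinvC)
    rw [hs1, one_mul] at h
    exact ⟨mul_inv_eq_one.mp hs1, rfl, mul_inv_eq_one.mp h⟩
  · exact absurd h (hT t ht t' ht' htt (s * s'⁻¹) (hA s hs s' hs') (u * u'⁻¹) (hC u hu u' hu'))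

/-- the same, as a `TripleProductProperty`. -/
theorem tripleProductProperty_of_closed_pair {A T C : Finset G}
    (hA : ∀ a ∈ A, ∀ a' ∈ A, a * a'⁻¹ ∈ A) (hC : ∀ c ∈ C, ∀ c' ∈ C, c * c'⁻¹ ∈ C)
    (hAC : ∀ x ∈ A, x ∈ C → x = 1)
    (hT : ∀ t ∈ T, ∀ t' ∈ T, t ≠ t' → ∀ a ∈ A, ∀ c ∈ C, a * (t * t'⁻¹) * c ≠ 1) :
    TripleProductProperty A T C := tpp_of_closed_pair hA hC hAC hT

/-- … hence `G` realizes `⟨|A|, |T|, |C|⟩`. -/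
theorem realizesTPP_of_closed_pair {A T C : Finset G}
    (hA : ∀ a ∈ A, ∀ a' ∈ A, a * a'⁻¹ ∈ A) (hC : ∀ c ∈ C, ∀ c' ∈ C, c * c'⁻¹ ∈ C)
    (hAC : ∀ x ∈ A, x ∈ C → x = 1)
    (hT : ∀ t ∈ T, ∀ t' ∈ T, t ≠ t' → ∀ a ∈ A, ∀ c ∈ C, a * (t * t'⁻¹) * c ≠ 1) :
    RealizesTPP G A.card T.card C.card := ⟨A, T, C, rfl, rfl, rfl, tpp_of_closed_pair hA hC hAC hT⟩

/-- **Subgroup + involution.** `A` closed under `x y⁻¹`, `σ` an involution outside `A`, and `T` with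
`t t'⁻¹ ∉ A ∪ A σ ∪ σ A` for `t ≠ t'` (stated as `a (t t'⁻¹) ≠ 1`, `a (t t'⁻¹) σ ≠ 1`): then `(A, T, {1, σ})` has the TPP. -/
theorem tpp_of_closed_involution [DecidableEq G] {A T : Finset G} {σ : G}
    (hA : ∀ a ∈ A, ∀ a' ∈ A, a * a'⁻¹ ∈ A) (hσ : σ * σ = 1) (hσA : σ ∉ A)
    (hT : ∀ t ∈ T, ∀ t' ∈ T, t ≠ t' → ∀ a ∈ A, a * (t * t'⁻¹) ≠ 1 ∧ a * (t * t'⁻¹) * σ ≠ 1) :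
    ∀ s ∈ A, ∀ s' ∈ A, ∀ t ∈ T, ∀ t' ∈ T, ∀ u ∈ ({1, σ} : Finset G), ∀ u' ∈ ({1, σ} : Finset G),
      s * s'⁻¹ * (t * t'⁻¹) * (u * u'⁻¹) = 1 → s = s' ∧ t = t' ∧ u = u' := by
  have hσinv : σ⁻¹ = σ := inv_eq_of_mul_eq_one_left hσ
  refine tpp_of_closed_pair hA ?_ ?_ ?_
  · intro c hc c' hc'
    simp only [Finset.mem_insert, Finset.mem_singleton] at hc hc' ⊢
    rcases hc with rfl | rfl <;> rcases hc' with rfl | rfl <;> simp [hσinv, hσ]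
  · intro x hx hxC
    simp only [Finset.mem_insert, Finset.mem_singleton] at hxC
    rcases hxC with rfl | rfl
    · rfl
    · exact absurd hx hσA
  · intro t ht t' ht' htt a ha c hc
    simp only [Finset.mem_insert, Finset.mem_singleton] at hc
    rcases hc with rfl | rfl
    · rw [mul_one]; exact (hT t ht t' ht' htt a ha).1
    · exact (hT t ht t' ht' htt a ha).2

/-- the same for two subgroups `H₁ ⊓ H₂ = ⊥` of a finite group, with `A = H₁`, `C = H₂` as `Finset`s. -/
theorem realizesTPP_of_subgroup_pair [Fintype G] (H₁ H₂ : Subgroup G) [DecidablePred (· ∈ H₁)] [DecidablePred (· ∈ H₂)]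
    (hdis : Disjoint H₁ H₂) {T : Finset G}
    (hT : ∀ t ∈ T, ∀ t' ∈ T, t ≠ t' → ∀ a ∈ H₁, ∀ c ∈ H₂, a * (t * t'⁻¹) * c ≠ 1) :
    RealizesTPP G (Finset.univ.filter (· ∈ H₁)).card T.card (Finset.univ.filter (· ∈ H₂)).card := by
  refine realizesTPP_of_closed_pair ?_ ?_ ?_ ?_
  · intro a ha a' ha'
    simp only [Finset.mem_filter, Finset.mem_univ, true_and] at ha ha' ⊢
    exact H₁.mul_mem ha (H₁.inv_mem ha')
  · intro c hc c' hc'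
    simp only [Finset.mem_filter, Finset.mem_univ, true_and] at hc hc' ⊢
    exact H₂.mul_mem hc (H₂.inv_mem hc')
  · intro x hx hxC
    simp only [Finset.mem_filter, Finset.mem_univ, true_and] at hx hxC
    exact Subgroup.disjoint_def.mp hdis hx hxC
  · intro t ht t' ht' htt a ha c hc
    simp only [Finset.mem_filter, Finset.mem_univ, true_and] at ha hc
    exact hT t ht t' ht' htt a ha c hc

end Summit.MatrixMultiplication.OmegaCensus.SubgroupPairTPP
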